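import Literature.Probability.LatticeModels.LatticeFaceParity
import Literature.Probability.LatticeModels.FKExplorationDomainMarkov
import Literature.Probability.LatticeModels.FKIsingHalfPlaneArm
import HarnessLib

/-!
# The exploration of the three-sided box up to its first visit of a diamond: the two sides of the crosscut

Topic `Literature/Probability/LatticeModels`; lattice topology for the slit-domain lower bound of the
`fkIsing_rsw` programme (Duminil-Copin 2013, proof of Lemma 10.7; DCHN 2011, proof of Lemma 15):
"if `γ(T) = z + (-r, r)` then the arc `z + l_r(-r)` disconnects the free arc from `z` in the
domain `R ∖ γ[0,T]`". Setting: the three-sided box `thrD N` (`[0, 2N] × [-1, N]`, free bottom row),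
the **diamond** `◇_K = {0 ≤ u₁, |u₀ - N| + u₁ ≤ K}` about the centre `(N, 0)` of the free row
(`IsDiamondSite`), and a configuration `ω₀` whose exploration first turns around a diamond site at
step `n` (`IsFirstDiamondVisit`: the corners `0, …, n-1` have their vertices off the diamond, the
`n`-th one, before the exit, has its vertex `t` on it). Then (§1) `t` lies on the boundary of the
diamond, `|t₀ - N| + t₁ = K`, and was reached along the open explored edge `e_{n-1}`; the vertices of
the prefix have nonnegative height and, except `t`, lie off the diamond.

§2 builds the **closed lattice walk `Γ`** (`crosscutWalk`) = the column below `t` inside the diamond,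
two steps down through the free row, the row `y = -2` leftwards to `(-2,-2)`, the column `x = -2` up to
`(-2, N)`, two steps right to the corner `(0, N)` of the wired arc, an `A`–`A` path, and a path `π` of
revealed open explored edges back to `t` (`exists_piWalk`, from `exists_reachable_of_mem_exploredWired`),
and classifies its darts (`crosscutWalk_dart_cases`): revealed open explored edges, `A`–`A` edges, the
column edges `{(c, y), (c, y+1)}`, `y < r`, the edge `{(c,0),(c,-1)}`, or edges leaving the box.

§3 reads off the **crossing parities** (`LatticeFaceParity.faceParity Γ`): all prefix faces
`cFace orbit_i`, `i ≤ n`, have the parity of the start face, which is odd (`prefixFace_odd`); the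
face `(N+K, 0)` at the right-most point `z = (N+K, 0)` of the diamond is even (`zFace_even`, `t ≠ z`);
the faces `(c, y)`, `y < r`, right of the column are even and those left of it odd
(`colRight_even`, `colLeft_odd`); the free-row faces `(x, -1)`, `x < c`, are odd (`corridorLeft_odd`);
and a side of a face carrying a dart of `Γ` with both endpoints in the box is a revealed open explored
edge, an `A`–`A` edge, a column edge or the foot edge (`edge_cases_of_dart`). These are the inputs of
the harmonic-measure comparison on the even faces (`FKSlitLowerBound.lean`).

Everything here is proved; no named fact; nothing assumes `fkIsing_rsw`.

## References

* H. Duminil-Copin, C. Hongler, P. Nolin, Comm. Pure Appl. Math. 64 (2011), §4, proof of Lemma 15 —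
  bib key `DuminilCopinHonglerNolin2011`.
* H. Duminil-Copin, *Parafermionic observables and their applications*, Ensaios Mat. 25 (2013),
  proof of Lemma 10.7 and Lemma 10.3.
-/

noncomputable section

namespace Literature.Probability.LatticeModels

open SimpleGraph Finset DiscreteDobrushin

namespace LatticeDobrushin

variable {N K : ℕ}

/-! ## §0 The diamond -/

/-- The **diamond** of radius `K` about the centre `(N, 0)` of the free row of `thrD N`: the sites
`u` with `0 ≤ u₁` and `|u₀ - N| + u₁ ≤ K` (the graph-distance ball `B_k(x)` of DCHN's Lemma 15, upper
half). [cite: DuminilCopinHonglerNolin2011, §4, Lemma 15] -/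
def IsDiamondSite (N K : ℕ) (u : Site 2) : Prop := 0 ≤ u 1 ∧ u 0 - N + u 1 ≤ K ∧ (N : ℤ) - u 0 + u 1 ≤ K

/-- Diamond sites lie in `[N-K, N+K] × [0, K]`. [folklore] -/
theorem IsDiamondSite.bounds {u : Site 2} (h : IsDiamondSite N K u) :
    (N : ℤ) - K ≤ u 0 ∧ u 0 ≤ N + K ∧ 0 ≤ u 1 ∧ u 1 ≤ K := by
  obtain ⟨h1, h2, h3⟩ := h; omega

/-- For `K + 1 ≤ N` no site of the wired arc of `thrD N` is a diamond site. [folklore] -/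
theorem not_isDiamondSite_of_mem_A (hKN : K + 1 ≤ N) {u : Site 2} (hu : u ∈ (threeSided (2 * N) N).A) : ¬ IsDiamondSite N K u := by
  rw [mem_threeSided_A] at hu
  rintro ⟨h1, h2, h3⟩
  obtain ⟨⟨-, -, -, -⟩, -, h | h | h⟩ := hu <;> push_cast at h <;> omega

/-- For `K + 1 ≤ N` a diamond site lies in `[1, 2N-1] × [0, N-1]`. [folklore] -/
theorem IsDiamondSite.interior (hKN : K + 1 ≤ N) {u : Site 2} (h : IsDiamondSite N K u) :
    1 ≤ u 0 ∧ u 0 + 1 ≤ 2 * (N : ℤ) ∧ 0 ≤ u 1 ∧ u 1 + 1 ≤ (N : ℤ) := by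
  obtain ⟨h1, h2, h3⟩ := h; omega

/-- The coordinates of the four unit vectors. [folklore] -/
theorem cornerUnit_apply_cases (k : Fin 4) :
    (cornerUnit k 0 = 1 ∧ cornerUnit k 1 = 0) ∨ (cornerUnit k 0 = -1 ∧ cornerUnit k 1 = 0) ∨
      (cornerUnit k 0 = 0 ∧ cornerUnit k 1 = 1) ∨ (cornerUnit k 0 = 0 ∧ cornerUnit k 1 = -1) := by
  fin_cases k <;> simp [cornerUnit]

/-! ## §1 The first visit of the diamond -/

section FirstVisit

variable (hN : 1 ≤ N)

/-- Admissibility of `thrD N` (`W = 2N ≥ 1`, `H = N ≥ 1`). [folklore] -/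
theorem thrD_adm (hN : 1 ≤ N) : (thrD N).IsZdAdmissible := isZdAdmissible_threeSided (W := 2 * N) (H := N) (by omega) hN

/-- The orbit of the start corner of `thrD N` in the completed configuration of `ω₀` (abbreviation). [folklore] -/
abbrev orbT (N : ℕ) (hN : 1 ≤ N) (ω₀ : Percolation.BondConfig (Site 2)) (j : ℕ) : Site 2 × Fin 4 :=
  cornerOrbit ((thrD N).bcBondConfig ω₀) (startCorner (thrD_adm hN)) j

/-- **The exploration first turns around a diamond site at step `n`**: the corners `0, …, n - 1` of
the orbit of the start corner have their vertices off the diamond, and the `n`-th, before the exit,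
has its vertex on it. [cite: DuminilCopinHonglerNolin2011, §4, proof of Lemma 15] -/
structure IsFirstDiamondVisit (N K : ℕ) (hN : 1 ≤ N) (ω₀ : Percolation.BondConfig (Site 2)) (n : ℕ) : Prop where
  /-- the visit happens before the exit -/
  lt_exitTime : n < exitTime (thrD_adm hN) ω₀
  /-- the vertex of the `n`-th corner is a diamond site -/
  hit : IsDiamondSite N K (orbT N hN ω₀ n).1
  /-- no earlier corner has its vertex on the diamond -/
  before : ∀ j < n, ¬ IsDiamondSite N K (orbT N hN ω₀ j).1

variable {hN} {ω₀ : Percolation.BondConfig (Site 2)} {n : ℕ}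

/-- The vertex of every corner of the orbit is a site of the box, off the free row: it has nonnegative
height and lies in `[0, 2N] × [0, N]`. [cite: Smirnov2001, §2] -/
theorem orb_fst_mem (j : ℕ) : (orbT N hN ω₀ j).1 ∈ (threeSided (2 * N) N).S ∧ 0 ≤ (orbT N hN ω₀ j).1 1 := by
  dsimp only [orbT]
  have hE := thrD_adm hN
  have hc : (thrD N).IsStartCorner (startCorner hE) := isStartCorner_startCorner hE
  have hmem : (orbT N hN ω₀ j).1 ∈ meshDomain (thrD N).Ω (thrD N).δ := by
    rcases cornerOrbit_inv hc j with h | ⟨e, he, hxe⟩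
    · exact (thrD N).zdBoundary_subset_meshDomain ((thrD N).zdArcA_subset_zdBoundary h)
    · have he' := (thrD N).bcBondConfig_subset ω₀ he
      induction e using Sym2.ind with
      | h u w =>
        rw [SimpleGraph.mem_edgeSet] at he'
        obtain ⟨-, hu, hw⟩ := discreteDomainGraph_adj_iff.1 he'
        rcases Sym2.mem_iff.1 hxe with h' | h'
        · rw [h']; exact hu
        · rw [h']; exact hw
  have hB := cornerOrbit_fst_not_mem_zdArcB hE hc ω₀ j
  refine ⟨by rw [← (threeSided (2 * N) N).meshDomain_eq]; exact hmem, height_nonneg_threeSided hmem hB⟩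

/-- Coordinates of the vertex of a corner of the orbit. [folklore] -/
theorem orb_fst_bounds (j : ℕ) : 0 ≤ (orbT N hN ω₀ j).1 0 ∧ (orbT N hN ω₀ j).1 0 ≤ 2 * (N : ℤ) ∧ 0 ≤ (orbT N hN ω₀ j).1 1 ∧ (orbT N hN ω₀ j).1 1 ≤ (N : ℤ) := by
  obtain ⟨hS, h1⟩ := orb_fst_mem (hN := hN) (ω₀ := ω₀) j
  rw [mem_threeSided_S] at hS
  omega

variable (hV : IsFirstDiamondVisit N K hN ω₀ n) (hKN : K + 1 ≤ N)
include hV hKN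

/-- The first visit is not at step `0` (the start vertex `(0,0)` is on the wired arc). [folklore] -/
theorem IsFirstDiamondVisit.pos : 1 ≤ n := by
  by_contra h
  have h0 : n = 0 := by omega
  have hhit := hV.hit
  dsimp only [orbT] at hhit
  rw [h0, cornerOrbit_zero, startCorner_threeSided_fst (W := 2 * N) (H := N) (by omega) hN] at hhit
  obtain ⟨-, -, h3⟩ := hhit
  simp at h3; omega

/-- **The tip was reached along an open edge**: the explored edge `e_{n-1}` is open in the completed
configuration, and the tip is `orb (n-1) .1 + cornerUnit (orb (n-1) .2 + 1)`. [cite: Smirnov2001, §2] -/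
theorem IsFirstDiamondVisit.open_pred :
    cTgt (orbT N hN ω₀ (n - 1)) ∈ (thrD N).bcBondConfig ω₀ ∧ (orbT N hN ω₀ n).1 = (orbT N hN ω₀ (n - 1)).1 + cornerUnit ((orbT N hN ω₀ (n - 1)).2 + 1) := by
  have hn := hV.pos hKN
  have hstep : orbT N hN ω₀ n = nextCorner ((thrD N).bcBondConfig ω₀) (orbT N hN ω₀ (n - 1)) := by
    have e : n = (n - 1) + 1 := by omega
    conv_lhs => rw [e]
    exact cornerOrbit_succ (n - 1)
  by_cases hopen : cTgt (orbT N hN ω₀ (n - 1)) ∈ (thrD N).bcBondConfig ω₀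
  · rw [hstep, nextCorner_of_mem hopen]; exact ⟨hopen, rfl⟩
  · exfalso
    have := hV.before (n - 1) (by omega)
    exact this (by have h := hV.hit; rwa [hstep, nextCorner_of_not_mem hopen] at h)

/-- **The tip is on the boundary of the diamond**: `|t₀ - N| + t₁ = K`. [cite: DuminilCopinHonglerNolin2011, §4, proof of Lemma 15] -/
theorem IsFirstDiamondVisit.tip_boundary :
    (orbT N hN ω₀ n).1 0 - N + (orbT N hN ω₀ n).1 1 = K ∨ (N : ℤ) - (orbT N hN ω₀ n).1 0 + (orbT N hN ω₀ n).1 1 = K := by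
  obtain ⟨-, ht⟩ := hV.open_pred hKN
  have hp := hV.before (n - 1) (by have := hV.pos hKN; omega)
  have hpb := orb_fst_bounds (hN := hN) (ω₀ := ω₀) (n - 1)
  obtain ⟨h1, h2, h3⟩ := hV.hit
  simp only [IsDiamondSite, not_and, not_le] at hp
  rw [ht] at h1 h2 h3 ⊢
  set v := (orbT N hN ω₀ (n - 1)).1
  set k := (orbT N hN ω₀ (n - 1)).2 + 1
  simp only [Pi.add_apply] at h1 h2 h3 ⊢
  rcases cornerUnit_apply_cases k with ⟨e0, e1⟩ | ⟨e0, e1⟩ | ⟨e0, e1⟩ | ⟨e0, e1⟩ <;> omega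

omit hKN in
/-- The height of the tip is at most `K` and its abscissa is within `K` of `N`. [folklore] -/
theorem IsFirstDiamondVisit.tip_bounds :
    0 ≤ (orbT N hN ω₀ n).1 1 ∧ (orbT N hN ω₀ n).1 1 ≤ K ∧ (N : ℤ) - K ≤ (orbT N hN ω₀ n).1 0 ∧ (orbT N hN ω₀ n).1 0 ≤ N + K := by
  have := hV.hit.bounds; omega

end FirstVisit

/-! ## §2 The path of revealed open edges and the crosscut walk -/

section Crosscut

variable {hN : 1 ≤ N} {ω₀ : Percolation.BondConfig (Site 2)} {n : ℕ}

/-- The edge `e` is a **revealed open explored edge** of the prefix of length `n`: `e = e_j(ω₀)` for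
some `j < n`, open in the completed configuration. [cite: DuminilCopinSmirnov2012Clay, §6.2] -/
def IsPiEdge (N : ℕ) (hN : 1 ≤ N) (ω₀ : Percolation.BondConfig (Site 2)) (n : ℕ) (e : Sym2 (Site 2)) : Prop :=
  ∃ j < n, e = exploredEdge (thrD_adm hN) ω₀ j ∧ exploredEdge (thrD_adm hN) ω₀ j ∈ (thrD N).bcBondConfig ω₀

/-- **A lattice path of revealed open explored edges from the tip of the prefix to the wired arc**
(every explored wired vertex hangs off the wired arc by revealed open edges,
`exists_reachable_of_mem_exploredWired`). [cite: DuminilCopinSmirnov2012Clay, §6.2, proof of Lemma 6.6] -/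
theorem exists_piWalk (hn : n < exitTime (thrD_adm hN) ω₀) :
    ∃ (b : Site 2) (π : (zdGraph 2).Walk (orbT N hN ω₀ n).1 b), b ∈ (threeSided (2 * N) N).A ∧
      ∀ d ∈ π.darts, IsPiEdge N hN ω₀ n d.edge := by
  classical
  have hE := thrD_adm hN
  set t := (orbT N hN ω₀ n).1 with ht
  have htm : t ∈ meshDomain (thrD N).Ω (thrD N).δ := by
    rw [(threeSided (2 * N) N).meshDomain_eq]; exact (orb_fst_mem (hN := hN) (ω₀ := ω₀) n).1
  set x : meshDomain (thrD N).Ω (thrD N).δ := ⟨t, htm⟩ with hx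
  have hxW : x ∈ exploredWired hE ω₀ n := Or.inr ⟨n, le_min le_rfl hn.le, rfl⟩
  obtain ⟨b', hb'A, ⟨W⟩⟩ := exists_reachable_of_mem_exploredWired hxW
  -- the inclusion of the graph of revealed open edges into `ℤ²`
  set GR := SimpleGraph.fromEdgeSet (↑(revealedOpenEdges hE ω₀ n) : Set (Sym2 (meshDomain (thrD N).Ω (thrD N).δ))) with hGR
  have hadj : ∀ u v : meshDomain (thrD N).Ω (thrD N).δ, GR.Adj u v → (zdGraph 2).Adj u.val v.val := by
    intro u v huv
    rw [hGR, SimpleGraph.fromEdgeSet_adj] at huv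
    have hmem : s(u, v) ∈ (thrD N).interfaceGraph.edgeFinset :=
      revealedEdges_subset ω₀ n (mem_revealedOpenEdges_iff.1 (Finset.mem_coe.1 huv.1)).1
    have := adj_and_not_mem_zdArcB_of_interfaceGraph_adj (SimpleGraph.mem_edgeFinset.1 hmem)
    exact ((threeSided (2 * N) N).adj_iff.1 this.1).1
  set f : GR →g zdGraph 2 := ⟨Subtype.val, fun {u v} h => hadj u v h⟩ with hf
  refine ⟨b'.val, W.map f, ?_, fun d hd => ?_⟩
  · have := hb'A
    change b'.val ∈ (thrD N).zdArcA at this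
    rwa [zdArcA_threeSided] at this
  · rw [SimpleGraph.Walk.darts_map, List.mem_map] at hd
    obtain ⟨d', -, rfl⟩ := hd
    have hadj' := d'.adj
    change (SimpleGraph.fromEdgeSet (↑(revealedOpenEdges hE ω₀ n) : Set (Sym2 (meshDomain (thrD N).Ω (thrD N).δ)))).Adj
      d'.fst d'.snd at hadj'
    obtain ⟨hmem, -⟩ := (SimpleGraph.fromEdgeSet_adj _).1 hadj'
    obtain ⟨hR, hω₀⟩ := mem_revealedOpenEdges_iff.1 (Finset.mem_coe.1 hmem)
    obtain ⟨-, j, hj, hje, hjf⟩ := mem_revealedEdges_iff.1 hR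
    have hedge : (f.mapDart d').edge = Sym2.map Subtype.val s(d'.fst, d'.snd) := by
      obtain ⟨⟨p, q⟩, hpq⟩ := d'; rfl
    refine ⟨j, lt_of_lt_of_le hj (min_le_left _ _), ?_, (mem_bcBondConfig_iff_of_isFreeEdge hjf ω₀).2 (hje ▸ hω₀)⟩
    rw [hedge, hje]

/-- The endpoints of a revealed open explored edge are vertices of the prefix or sites of the wired
arc, hence of nonnegative height; and they are not both on the diamond's side of the first visit:
for `j < n` the left vertex `(orbT N hN ω₀ j).1` is an endpoint of `e_j` and lies off the diamond. [folklore] -/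
theorem IsPiEdge.mem (hV : IsFirstDiamondVisit N K hN ω₀ n) {e : Sym2 (Site 2)} (he : IsPiEdge N hN ω₀ n e) :
    (∃ x ∈ e, ¬ IsDiamondSite N K x ∧ 0 ≤ x 1 ∧ x ∈ (threeSided (2 * N) N).S) ∧ ∀ x ∈ e, 0 ≤ x 1 ∧ x ∈ (threeSided (2 * N) N).S := by
  obtain ⟨j, hj, rfl, hopen⟩ := he
  have hv := orb_fst_mem (hN := hN) (ω₀ := ω₀) j
  refine ⟨⟨(orbT N hN ω₀ j).1, by rw [exploredEdge, cTgt]; exact Sym2.mem_mk_left _ _, hV.before j hj, hv.2, hv.1⟩, fun x hx => ?_⟩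
  rw [exploredEdge, cTgt, Sym2.mem_iff] at hx
  rcases hx with rfl | rfl
  · exact ⟨hv.2, hv.1⟩
  · have hnext : cornerOrbit ((thrD N).bcBondConfig ω₀) (startCorner (thrD_adm hN)) (j + 1) =
        ((orbT N hN ω₀ j).1 + cornerUnit ((orbT N hN ω₀ j).2 + 1), (orbT N hN ω₀ j).2 + 3) := by
      rw [cornerOrbit_succ]; exact nextCorner_of_mem hopen
    have hv' := orb_fst_mem (hN := hN) (ω₀ := ω₀) (j + 1)
    dsimp only [orbT] at hv'
    rw [hnext] at hv'
    exact ⟨hv'.2, hv'.1⟩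

/-! ### The crosscut walk -/

/-- The endpoint of the run down the column below the tip `t`, through the free row, to `(t₀, -2)`. [folklore] -/
theorem colRun_end {t : Site 2} (ht : 0 ≤ t 1) : t + ((t 1).toNat + 2) • cornerUnit 3 = ![t 0, -2] := by
  have h1 : (((t 1).toNat : ℕ) : ℤ) = t 1 := Int.toNat_of_nonneg ht
  funext i; fin_cases i
  · simp [cornerUnit, Pi.add_apply, nsmul_eq_mul]
  · simp [cornerUnit, Pi.add_apply, nsmul_eq_mul]; omega

/-- The endpoint of the run along the row `y = -2` from `(c, -2)` to `(-2, -2)`. [folklore] -/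
theorem rowRun_end {c : ℤ} (hc : 0 ≤ c) : (![c, -2] : Site 2) + ((c.toNat + 2 : ℕ)) • cornerUnit 2 = ![-2, -2] := by
  have h1 : ((c.toNat : ℕ) : ℤ) = c := Int.toNat_of_nonneg hc
  funext i; fin_cases i
  · simp [cornerUnit, Pi.add_apply, nsmul_eq_mul]; omega
  · simp [cornerUnit, Pi.add_apply, nsmul_eq_mul]

/-- The endpoint of the run up the column `x = -2` from `(-2,-2)` to `(-2, N)`. [folklore] -/
theorem upRun_end (N : ℕ) : (![-2, -2] : Site 2) + (N + 2) • cornerUnit 1 = ![-2, (N : ℤ)] := by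
  funext i; fin_cases i <;> simp [cornerUnit, Pi.add_apply, nsmul_eq_mul]

/-- The endpoint of the two steps right from `(-2, N)` to the corner `(0, N)` of the wired arc. [folklore] -/
theorem inRun_end (N : ℕ) : (![-2, (N : ℤ)] : Site 2) + 2 • cornerUnit 0 = ![0, (N : ℤ)] := by
  funext i; fin_cases i <;> simp [cornerUnit, Pi.add_apply]

/-- The endpoint of the run up the wall from `b` to `(b₀, N)`. [folklore] -/
theorem wallUp_end {b : Site 2} {N : ℕ} (hb : b 1 ≤ N) : b + (((N : ℤ) - b 1).toNat) • cornerUnit 1 = ![b 0, (N : ℤ)] := by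
  have h1 : ((((N : ℤ) - b 1).toNat : ℕ) : ℤ) = N - b 1 := Int.toNat_of_nonneg (by omega)
  funext i; fin_cases i
  · simp [cornerUnit, Pi.add_apply, nsmul_eq_mul]
  · simp [cornerUnit, Pi.add_apply, nsmul_eq_mul]; omega

/-- The endpoint of the run along the top row from `(b₀, N)` to `(0, N)`. [folklore] -/
theorem wallLeft_end {b : Site 2} {N : ℕ} (hb : 0 ≤ b 0) : (![b 0, (N : ℤ)] : Site 2) + ((b 0).toNat) • cornerUnit 2 = ![0, (N : ℤ)] := by
  have h1 : (((b 0).toNat : ℕ) : ℤ) = b 0 := Int.toNat_of_nonneg hb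
  funext i; fin_cases i
  · simp [cornerUnit, Pi.add_apply, nsmul_eq_mul]; omega
  · simp [cornerUnit, Pi.add_apply, nsmul_eq_mul]

/-- **The wall walk** from a site `b` of the wired arc to its corner `(0, N)`: up the column of `b` to
the top row, then left along the top row (all along `A`–`A` edges). [folklore] -/
def wallWalk (N : ℕ) (b : Site 2) (hb : 0 ≤ b 0 ∧ b 1 ≤ N) : (zdGraph 2).Walk b ![0, (N : ℤ)] :=
  ((unitRun 1 (((N : ℤ) - b 1).toNat) b).copy rfl (wallUp_end hb.2)).append
    ((unitRun 2 ((b 0).toNat) ![b 0, (N : ℤ)]).copy rfl (wallLeft_end hb.1))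

/-- **The crosscut walk** `Γ` of the first visit: down the column below the tip `t` and through the
free row to `(t₀, -2)`, left along the row `y = -2` to `(-2,-2)`, up the column `x = -2` to `(-2, N)`,
right to the corner `(0, N)` of the wired arc, along the wired arc to `b` (the wall walk reversed),
and back to `t` along the path `π` of revealed open edges (reversed). A closed lattice walk whose
"inside the box" part is the crosscut `π ∪ column` of Duminil-Copin–Hongler–Nolin's proof of
Lemma 15 (`z + l_r(-r)` together with `γ[0,T]`'s wired side). [cite: DuminilCopinHonglerNolin2011, §4, proof of Lemma 15] -/
def crosscutWalk (N : ℕ) (t b : Site 2) (ht : 0 ≤ t 0 ∧ 0 ≤ t 1) (hb : 0 ≤ b 0 ∧ b 1 ≤ N) (π : (zdGraph 2).Walk t b) :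
    (zdGraph 2).Walk t t :=
  (((((unitRun 3 ((t 1).toNat + 2) t).copy rfl (colRun_end ht.2)).append
    ((unitRun 2 ((t 0).toNat + 2) ![t 0, -2]).copy rfl (rowRun_end ht.1))).append
    ((unitRun 1 (N + 2) ![-2, -2]).copy rfl (upRun_end N))).append
    ((unitRun 0 2 ![-2, (N : ℤ)]).copy rfl (inRun_end N))).append
    ((wallWalk N b hb).reverse.append π.reverse)

/-- **The darts of the crosscut walk**: a dart of `Γ` lies on the column-and-foot run, the row run,
the up run, the two entering steps, the wall walk, or the path `π`. [folklore] -/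
theorem mem_darts_crosscutWalk {t b : Site 2} {ht : 0 ≤ t 0 ∧ 0 ≤ t 1} {hb : 0 ≤ b 0 ∧ b 1 ≤ N}
    {π : (zdGraph 2).Walk t b} {d : (zdGraph 2).Dart} (hd : d ∈ (crosscutWalk N t b ht hb π).darts) :
    d ∈ (unitRun 3 ((t 1).toNat + 2) t).darts ∨ d ∈ (unitRun 2 ((t 0).toNat + 2) ![t 0, -2]).darts ∨
      d ∈ (unitRun 1 (N + 2) ![-2, -2]).darts ∨ d ∈ (unitRun 0 2 ![-2, (N : ℤ)]).darts ∨
      d.symm ∈ (unitRun 1 (((N : ℤ) - b 1).toNat) b).darts ∨ d.symm ∈ (unitRun 2 ((b 0).toNat) ![b 0, (N : ℤ)]).darts ∨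
      d.symm ∈ π.darts := by
  simp only [crosscutWalk, wallWalk, SimpleGraph.Walk.darts_append, SimpleGraph.Walk.darts_copy, List.mem_append,
    SimpleGraph.Walk.mem_darts_reverse] at hd
  tauto


/-! ### Counting darts of reversed walks -/

open scoped Classical in
/-- `countP` of a reversed list. [folklore] -/
theorem countP_reverse' {α : Type*} (p : α → Bool) (l : List α) : l.reverse.countP p = l.countP p := by
  induction l with
  | nil => rfl
  | cons a l ih => simp [List.countP_append, ih, List.countP_cons]

open scoped Classical in
/-- `countP` along `Dart.symm` for a symmetric predicate. [folklore] -/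
theorem countP_map_symm {G : SimpleGraph (Site 2)} (P : G.Dart → Prop) (hP : ∀ d, P d.symm ↔ P d) (l : List G.Dart) :
    (l.map SimpleGraph.Dart.symm).countP (fun d => decide (P d)) = l.countP (fun d => decide (P d)) := by
  induction l with
  | nil => rfl
  | cons a l ih => simp [List.countP_cons, ih, hP a]

open scoped Classical in
/-- The darts of a reversed walk satisfy a symmetric predicate as often as those of the walk. [folklore] -/
theorem countP_darts_reverse {G : SimpleGraph (Site 2)} {u v : Site 2} (W : G.Walk u v) (P : G.Dart → Prop)
    (hP : ∀ d, P d.symm ↔ P d) :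
    W.reverse.darts.countP (fun d => decide (P d)) = W.darts.countP (fun d => decide (P d)) := by
  rw [SimpleGraph.Walk.darts_reverse, countP_reverse', countP_map_symm P hP]

/-- `DownDart` is symmetric in the direction of the dart. [folklore] -/
theorem downDart_symm_iff (m h : ℤ) (d : (zdGraph 2).Dart) : DownDart m h d.symm ↔ DownDart m h d := by
  simp only [DownDart, SimpleGraph.Dart.symm_toProd, Prod.fst_swap, Prod.snd_swap]
  constructor <;> rintro ⟨h1, h2, h3⟩ <;> exact ⟨h1.symm, by omega, by tauto⟩

/-- `OnVEdge` is symmetric in the direction of the dart. [folklore] -/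
theorem onVEdge_symm_iff (c r : ℤ) (d : (zdGraph 2).Dart) : OnVEdge c r d.symm ↔ OnVEdge c r d := by
  simp only [OnVEdge, SimpleGraph.Dart.symm_toProd, Prod.fst_swap, Prod.snd_swap]
  tauto

open scoped Classical in
/-- A run in the direction `e₁` at an abscissa `≠ c` has no dart on the vertical edges at `c`. [folklore] -/
theorem countP_onVEdge_unitRun_one_of_ne {x : Site 2} {c : ℤ} (hx : x 0 ≠ c) (n : ℕ) (r : ℤ) :
    (unitRun 1 n x).darts.countP (fun d => decide (OnVEdge c r d)) = 0 := by
  rw [List.countP_eq_zero]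
  intro d hd
  obtain ⟨i, -, h1, -⟩ := (mem_darts_unitRun_iff 1 n x d).1 hd
  simp only [decide_eq_true_eq]
  rintro ⟨h0, -, -⟩
  have e1 := congrFun h1 0
  rw [add_nsmul_cornerUnit_apply] at e1
  simp [cornerUnit] at e1
  exact hx (by rw [← e1, h0])

end Crosscut

/-! ## §3 The darts of the crosscut walk and the crossing parities -/

section Parities

variable {hN : 1 ≤ N} {ω₀ : Percolation.BondConfig (Site 2)} {n : ℕ} (hV : IsFirstDiamondVisit N K hN ω₀ n) (hKN : K + 1 ≤ N)

include hV hKN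

omit hV hKN in
/-- The tip's coordinates are nonnegative (hypothesis of `crosscutWalk`). [folklore] -/
theorem orbT_nonneg (hN : 1 ≤ N) (ω₀ : Percolation.BondConfig (Site 2)) (n : ℕ) : 0 ≤ (orbT N hN ω₀ n).1 0 ∧ 0 ≤ (orbT N hN ω₀ n).1 1 := by
  have := (orb_fst_bounds (hN := hN) (ω₀ := ω₀) n); exact ⟨this.1, this.2.2.1⟩

omit hV hKN in
/-- Bounds of a site of the wired arc (hypothesis of `crosscutWalk`). [folklore] -/
theorem wall_bounds {b : Site 2} (hbA : b ∈ (threeSided (2 * N) N).A) : 0 ≤ b 0 ∧ b 1 ≤ N := by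
  rw [mem_threeSided_A] at hbA; exact ⟨hbA.1.1, hbA.1.2.2.2⟩

omit hV hKN in
/-- A site of the wired arc reached by a nontrivial climb is on a lateral wall. [folklore] -/
theorem wall_lateral {b : Site 2} (hbA : b ∈ (threeSided (2 * N) N).A) (h : b 1 < N) : b 0 = 0 ∨ b 0 = 2 * (N : ℤ) := by
  rw [mem_threeSided_A] at hbA
  rcases hbA.2.2 with h' | h' | h'
  · exact Or.inl h'
  · exact Or.inr h'
  · omega

omit hKN in
/-- **An endpoint of a revealed open explored edge is off the diamond or is the tip**: its endpoints are
the left vertices `(orbT N hN ω₀ j).1`, `(orb (j+1)).1` with `j < n`. [cite: Smirnov2001, §2] -/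
theorem IsPiEdge.not_isDiamondSite_or_eq_tip {e : Sym2 (Site 2)} (he : IsPiEdge N hN ω₀ n e) {x : Site 2} (hx : x ∈ e) :
    ¬ IsDiamondSite N K x ∨ x = (orbT N hN ω₀ n).1 := by
  obtain ⟨j, hj, rfl, hopen⟩ := he
  rw [exploredEdge, cTgt, Sym2.mem_iff] at hx
  rcases hx with rfl | rfl
  · exact Or.inl (hV.before j hj)
  · have hnext : cornerOrbit ((thrD N).bcBondConfig ω₀) (startCorner (thrD_adm hN)) (j + 1) =
        ((orbT N hN ω₀ j).1 + cornerUnit ((orbT N hN ω₀ j).2 + 1), (orbT N hN ω₀ j).2 + 3) := by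
      rw [cornerOrbit_succ]; exact nextCorner_of_mem hopen
    rcases Nat.lt_or_ge (j + 1) n with h | h
    · left; have := hV.before (j + 1) h; dsimp only [orbT] at this; rwa [hnext] at this
    · right
      have : j + 1 = n := by omega
      rw [← this]; dsimp only [orbT]; rw [hnext]

omit hKN in
/-- A revealed open explored edge has an endpoint off the diamond. [folklore] -/
theorem IsPiEdge.exists_not_isDiamondSite {e : Sym2 (Site 2)} (he : IsPiEdge N hN ω₀ n e) :
    ∃ x ∈ e, ¬ IsDiamondSite N K x := by
  obtain ⟨⟨x, hx, hxD, -⟩, -⟩ := he.mem hV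
  exact ⟨x, hx, hxD⟩

/-- **No dart of the crosscut walk at a diamond site other than the tip and the column sites.**
[cite: DuminilCopinHonglerNolin2011, §4, proof of Lemma 15] -/
theorem not_mem_edge_of_isDiamondSite {b : Site 2} (hbA : b ∈ (threeSided (2 * N) N).A)
    {π : (zdGraph 2).Walk (orbT N hN ω₀ n).1 b} (hπ : ∀ d ∈ π.darts, IsPiEdge N hN ω₀ n d.edge)
    {v : Site 2} (hv : IsDiamondSite N K v) (hvt : v ≠ (orbT N hN ω₀ n).1) (hvc : v 0 ≠ (orbT N hN ω₀ n).1 0)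
    {d : (zdGraph 2).Dart} (hd : d ∈ (crosscutWalk N (orbT N hN ω₀ n).1 b (orbT_nonneg hN ω₀ n) (wall_bounds hbA) π).darts) :
    v ∉ d.edge := by
  have ht := hV.tip_bounds
  obtain ⟨hv1, hv2, hv3⟩ := hv
  intro hmem
  rcases mem_darts_crosscutWalk hd with h | h | h | h | h | h | h
  · -- the column and foot run: abscissa `t 0`
    obtain ⟨i, -, rfl⟩ := edge_mem_of_mem_darts_unitRun h hmem
    exact hvc (by rw [add_nsmul_cornerUnit_apply]; simp [cornerUnit])
  · -- the row `y = -2`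
    obtain ⟨i, -, rfl⟩ := edge_mem_of_mem_darts_unitRun h hmem
    simp only [add_nsmul_cornerUnit_apply] at hv1; simp [cornerUnit] at hv1
  · -- the column `x = -2`
    obtain ⟨i, -, rfl⟩ := edge_mem_of_mem_darts_unitRun h hmem
    simp only [add_nsmul_cornerUnit_apply] at hv1 hv2 hv3; simp [cornerUnit] at hv1 hv2 hv3; omega
  · -- the two entering steps at height `N`
    obtain ⟨i, hi, rfl⟩ := edge_mem_of_mem_darts_unitRun h hmem
    simp only [add_nsmul_cornerUnit_apply] at hv1 hv2 hv3; simp [cornerUnit] at hv1 hv2 hv3; omega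
  · -- the wall: up the column of `b`
    rw [← SimpleGraph.Dart.edge_symm] at hmem
    obtain ⟨i, hi, rfl⟩ := edge_mem_of_mem_darts_unitRun h hmem
    have hb := wall_bounds hbA
    rw [mem_threeSided_A] at hbA
    simp only [add_nsmul_cornerUnit_apply] at hv1 hv2 hv3
    simp [cornerUnit] at hv1 hv2 hv3
    rcases hbA.2.2 with h' | h' | h'
    · omega
    · omega
    · -- `b` on the top row: the climb is trivial
      have : ((N : ℤ) - b 1).toNat = 0 := by rw [h']; simp
      omega
  · -- the wall: along the top row
    rw [← SimpleGraph.Dart.edge_symm] at hmem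
    obtain ⟨i, hi, rfl⟩ := edge_mem_of_mem_darts_unitRun h hmem
    simp only [add_nsmul_cornerUnit_apply] at hv1 hv2 hv3; simp [cornerUnit] at hv1 hv2 hv3; omega
  · -- the path `π`
    rw [← SimpleGraph.Dart.edge_symm] at hmem
    rcases (hπ _ h).not_isDiamondSite_or_eq_tip hV hmem with h' | h'
    · exact h' ⟨hv1, hv2, hv3⟩
    · exact hvt h'

/-- **No dart of the crosscut walk lies on a closed explored edge of the prefix** (`i < n`,
`e_i ∉` completed configuration): the darts of `π` and of the wall lie on open edges, the column
edges join two diamond sites whereas `e_i` has the endpoint `(orbT N hN ω₀ i).1` off the diamond, the foot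
edge would force `(orbT N hN ω₀ i).1 = (t₀, 0)` onto the diamond, and the remaining darts leave the box.
[cite: DuminilCopinHonglerNolin2011, §4, proof of Lemma 15] -/
theorem edge_ne_of_closed_exploredEdge {b : Site 2} (hbA : b ∈ (threeSided (2 * N) N).A)
    {π : (zdGraph 2).Walk (orbT N hN ω₀ n).1 b} (hπ : ∀ d ∈ π.darts, IsPiEdge N hN ω₀ n d.edge)
    {i : ℕ} (hi : i < n) (hclosed : exploredEdge (thrD_adm hN) ω₀ i ∉ (thrD N).bcBondConfig ω₀)
    {d : (zdGraph 2).Dart} (hd : d ∈ (crosscutWalk N (orbT N hN ω₀ n).1 b (orbT_nonneg hN ω₀ n) (wall_bounds hbA) π).darts) :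
    d.edge ≠ exploredEdge (thrD_adm hN) ω₀ i := by
  have hE := thrD_adm hN
  have ht := hV.tip_bounds
  have htb := hV.tip_boundary hKN
  have hiN : i < exitTime hE ω₀ := hi.trans hV.lt_exitTime
  have hedom : exploredEdge hE ω₀ i ∈ (discreteDomainGraph (thrD N).Ω (thrD N).δ).edgeSet := exploredEdge_mem_edgeSet hiN
  -- endpoints of `e_i`: in `S`, the left vertex off the diamond, both of nonnegative height
  have hS : ∀ x ∈ exploredEdge hE ω₀ i, x ∈ (threeSided (2 * N) N).S := by
    intro x hx
    have := exploredEdge_mem_edgeSet hiN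
    rw [exploredEdge, cTgt] at this hx
    have h' := (threeSided (2 * N) N).mem_edgeSet_iff.1 this
    rcases Sym2.mem_iff.1 hx with rfl | rfl
    · exact h'.2.1
    · exact h'.2.2
  have hvi := hV.before i hi
  have hvimem : (orbT N hN ω₀ i).1 ∈ exploredEdge hE ω₀ i := by rw [exploredEdge, cTgt]; exact Sym2.mem_mk_left _ _
  have hvib := orb_fst_bounds (hN := hN) (ω₀ := ω₀) i
  intro heq
  rcases mem_darts_crosscutWalk hd with h | h | h | h | h | h | h
  · -- column and foot run: the `j`-th dart joins `t - j e₁` to `t - (j+1) e₁`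
    obtain ⟨j, hj, h1, h2⟩ := (mem_darts_unitRun_iff 3 _ _ d).1 h
    have hx := hvimem
    rw [← heq, SimpleGraph.Dart.edge, Sym2.mem_iff, h1, h2] at hx
    simp only [IsDiamondSite, not_and, not_le] at hvi
    rcases hx with hx | hx <;> rw [hx] at hvi hvib <;> simp only [add_nsmul_cornerUnit_apply] at hvi hvib <;>
      simp [cornerUnit] at hvi hvib <;> omega
  · -- row `y = -2`: leaves the box
    obtain ⟨j, -, h1, -⟩ := (mem_darts_unitRun_iff 2 _ _ d).1 h
    have := hS d.fst (by rw [← heq, SimpleGraph.Dart.edge]; exact Sym2.mem_mk_left _ _)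
    rw [h1, mem_threeSided_S, add_nsmul_cornerUnit_apply, add_nsmul_cornerUnit_apply] at this
    simp [cornerUnit] at this
  · -- column `x = -2`
    obtain ⟨j, -, h1, -⟩ := (mem_darts_unitRun_iff 1 _ _ d).1 h
    have := hS d.fst (by rw [← heq, SimpleGraph.Dart.edge]; exact Sym2.mem_mk_left _ _)
    rw [h1, mem_threeSided_S, add_nsmul_cornerUnit_apply, add_nsmul_cornerUnit_apply] at this
    simp [cornerUnit] at this
  · -- entering steps: start at abscissa `-2 + j ≤ -1`
    obtain ⟨j, hj, h1, -⟩ := (mem_darts_unitRun_iff 0 _ _ d).1 h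
    have := hS d.fst (by rw [← heq, SimpleGraph.Dart.edge]; exact Sym2.mem_mk_left _ _)
    rw [h1, mem_threeSided_S, add_nsmul_cornerUnit_apply, add_nsmul_cornerUnit_apply] at this
    simp [cornerUnit] at this
    omega
  · -- wall, up: an `A`–`A` edge is open
    have hmem : d.symm.edge = exploredEdge hE ω₀ i := by rw [SimpleGraph.Dart.edge_symm]; exact heq
    obtain ⟨j, hj, h1, h2⟩ := (mem_darts_unitRun_iff 1 _ _ d.symm).1 h
    apply hclosed
    rw [← heq, ← SimpleGraph.Dart.edge_symm]
    refine mem_bcBondConfig_of_arcA (by rw [hmem]; exact hedom) fun x hx => ?_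
    rw [zdArcA_threeSided, mem_threeSided_A]
    have hb := wall_bounds hbA
    have hlat : b 0 = 0 ∨ b 0 = 2 * (N : ℤ) := wall_lateral hbA (by
      by_contra hge; have : ((N : ℤ) - b 1).toNat = 0 := by simp; omega
      omega)
    rw [mem_threeSided_A] at hbA
    rw [SimpleGraph.Dart.edge, Sym2.mem_iff, h1, h2] at hx
    have htoNat : ((((N : ℤ) - b 1).toNat : ℕ) : ℤ) = N - b 1 := Int.toNat_of_nonneg (by omega)
    rcases hx with rfl | rfl <;> simp only [add_nsmul_cornerUnit_apply] <;> simp [cornerUnit] <;> omega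
  · -- wall, top row: an `A`–`A` edge is open
    have hmem : d.symm.edge = exploredEdge hE ω₀ i := by rw [SimpleGraph.Dart.edge_symm]; exact heq
    obtain ⟨j, hj, h1, h2⟩ := (mem_darts_unitRun_iff 2 _ _ d.symm).1 h
    apply hclosed
    rw [← heq, ← SimpleGraph.Dart.edge_symm]
    refine mem_bcBondConfig_of_arcA (by rw [hmem]; exact hedom) fun x hx => ?_
    rw [zdArcA_threeSided, mem_threeSided_A]
    have hb := wall_bounds hbA
    rw [mem_threeSided_A] at hbA
    rw [SimpleGraph.Dart.edge, Sym2.mem_iff, h1, h2] at hx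
    have htoNat : (((b 0).toNat : ℕ) : ℤ) = b 0 := Int.toNat_of_nonneg hb.1
    rcases hx with rfl | rfl <;> simp only [add_nsmul_cornerUnit_apply] <;> simp [cornerUnit] <;> omega
  · -- `π`: open edges
    obtain ⟨j, -, hje, hopen⟩ := hπ _ h
    rw [SimpleGraph.Dart.edge_symm] at hje
    exact hclosed (heq ▸ hje ▸ hopen)


/-! ### The crossing counts of the crosscut walk -/

omit hV hKN in
/-- **The crosscut walk of the first visit** (abbreviation): `crosscutWalk` at the tip, with the wall
walk from `b ∈ A` and the path `π`. [cite: DuminilCopinHonglerNolin2011, §4, proof of Lemma 15] -/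
abbrev fvWalk (hN : 1 ≤ N) (ω₀ : Percolation.BondConfig (Site 2)) (n : ℕ) {b : Site 2} (hbA : b ∈ (threeSided (2 * N) N).A)
    (π : (zdGraph 2).Walk (orbT N hN ω₀ n).1 b) : (zdGraph 2).Walk (orbT N hN ω₀ n).1 (orbT N hN ω₀ n).1 :=
  crosscutWalk N (orbT N hN ω₀ n).1 b (orbT_nonneg hN ω₀ n) (wall_bounds hbA) π

omit hV hKN in
/-- The right-most point `z = (N + K, 0)` of the diamond is a diamond site. [folklore] -/
theorem isDiamondSite_z (N K : ℕ) : IsDiamondSite N K ![(N : ℤ) + K, 0] := by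
  refine ⟨by simp, by simp, by simp⟩

open scoped Classical in
/-- **The downward crossing counts of the crosscut walk** below the box and at the face of `z`: for a
face `(m, h)` with `0 ≤ m` and `h = -1`, or `h = 0`, `m = N + K` when the tip is not `z`, the only
darts of `Γ` crossing the downward ray are those of the row `y = -2`, which runs from abscissa `t₀`
to `-2`: the count is `1` if `m + 1 ≤ t₀` and `0` otherwise. [cite: DuminilCopinHonglerNolin2011, §4, proof of Lemma 15] -/
theorem downCount_fvWalk {b : Site 2} (hbA : b ∈ (threeSided (2 * N) N).A)
    {π : (zdGraph 2).Walk (orbT N hN ω₀ n).1 b} (hπ : ∀ d ∈ π.darts, IsPiEdge N hN ω₀ n d.edge)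
    {m h : ℤ} (hm : 0 ≤ m) (hh : h = -1 ∨ (h = 0 ∧ m = N + K ∧ (orbT N hN ω₀ n).1 ≠ ![(N : ℤ) + K, 0])) :
    downCount (fvWalk hN ω₀ n hbA π) m h = if m + 1 ≤ (orbT N hN ω₀ n).1 0 then 1 else 0 := by
  classical
  have ht := hV.tip_bounds
  have hb := wall_bounds hbA
  have hh' : h ≤ 0 := by rcases hh with rfl | ⟨rfl, -⟩ <;> norm_num
  -- the darts of `π` do not cross these rays
  have hπ0 : π.darts.countP (fun d => decide (DownDart m h d)) = 0 := by
    rw [List.countP_eq_zero]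
    intro d hd
    simp only [decide_eq_true_eq]
    rintro ⟨h1, h2, h3⟩
    have hmem := (hπ d hd).mem hV
    obtain ⟨-, hall⟩ := hmem
    have hf := (hall d.fst (by rw [SimpleGraph.Dart.edge]; exact Sym2.mem_mk_left _ _)).1
    rcases hh with rfl | ⟨rfl, rfl, htz⟩
    · omega
    · -- the dart runs along the free row through `z`
      have hz : (![(N : ℤ) + K, 0] : Site 2) ∈ d.edge := by
        rw [SimpleGraph.Dart.edge, Sym2.mem_iff]
        rcases h3 with ⟨h3, -⟩ | ⟨-, h3⟩
        · left; funext i; fin_cases i <;> simp <;> omega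
        · right; funext i; fin_cases i <;> simp <;> omega
      rcases (hπ d hd).not_isDiamondSite_or_eq_tip hV hz with h' | h'
      · exact h' (isDiamondSite_z N K)
      · exact htz h'.symm
  unfold downCount
  simp only [fvWalk, crosscutWalk, wallWalk, SimpleGraph.Walk.darts_append, SimpleGraph.Walk.darts_copy, List.countP_append]
  rw [countP_darts_reverse _ _ (downDart_symm_iff m h), countP_darts_reverse _ _ (downDart_symm_iff m h), hπ0]
  simp only [SimpleGraph.Walk.darts_append, SimpleGraph.Walk.darts_copy, List.countP_append]
  rw [countP_downDart_unitRun_vertical (Or.inr rfl), countP_downDart_unitRun_two, countP_downDart_unitRun_vertical (Or.inl rfl),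
    countP_downDart_unitRun_zero, countP_downDart_unitRun_vertical (Or.inl rfl), countP_downDart_unitRun_two]
  have e1 : ((((orbT N hN ω₀ n).1 0).toNat + 2 : ℕ) : ℤ) = (orbT N hN ω₀ n).1 0 + 2 := by
    push_cast; rw [Int.toNat_of_nonneg (by omega)]
  have e2 : (((b 0).toNat : ℕ) : ℤ) = b 0 := Int.toNat_of_nonneg hb.1
  simp only [Matrix.cons_val_zero, Matrix.cons_val_one, e1, e2]
  have hN1 : (1 : ℤ) ≤ N := by exact_mod_cast hN
  by_cases hc : m + 1 ≤ (orbT N hN ω₀ n).1 0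
  · rw [if_pos ⟨by omega, by omega, hc⟩, if_neg (by push_cast; omega), if_neg (by omega), if_pos hc]
  · rw [if_neg (by omega), if_neg (by push_cast; omega), if_neg (by omega), if_neg hc]

/-- **The prefix faces have the parity of the start face**: consecutive prefix faces coincide (the
edge was followed) or share the crossed edge, which is closed, hence carries no dart of `Γ`
(`edge_ne_of_closed_exploredEdge`). [cite: DuminilCopinHonglerNolin2011, §4, proof of Lemma 15] -/
theorem faceParity_prefix {b : Site 2} (hbA : b ∈ (threeSided (2 * N) N).A)
    {π : (zdGraph 2).Walk (orbT N hN ω₀ n).1 b} (hπ : ∀ d ∈ π.darts, IsPiEdge N hN ω₀ n d.edge) :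
    ∀ i ≤ n, (faceParity (fvWalk hN ω₀ n hbA π) (cFace (orbT N hN ω₀ i)) ↔
      faceParity (fvWalk hN ω₀ n hbA π) (cFace (orbT N hN ω₀ 0))) := by
  intro i hi
  induction i with
  | zero => exact Iff.rfl
  | succ i ih =>
    rw [← ih (by omega)]
    set p := orbT N hN ω₀ i with hp
    have hstep : orbT N hN ω₀ (i + 1) = nextCorner ((thrD N).bcBondConfig ω₀) p := cornerOrbit_succ i
    by_cases hopen : cTgt p ∈ (thrD N).bcBondConfig ω₀
    · -- followed: the same face
      rw [hstep, nextCorner_of_mem hopen]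
      simp only [cFace]
      rw [show p.2 + 3 = (p.2 + 1) + 2 by omega, faceAt_add_unit_add_two, show p.2 + 1 + 3 = p.2 by omega]
    · -- crossed: the neighbouring face across the closed edge `e_i`
      rw [hstep, nextCorner_of_not_mem hopen]
      simp only [cFace]
      rw [faceAt_succ_eq]
      refine faceParity_add_cornerUnit_iff _ _ _ fun d hd => ?_
      rw [faceSide_faceAt_add_two]
      exact edge_ne_of_closed_exploredEdge hV hKN hbA hπ (by omega) hopen hd

omit hV hKN in
/-- The start face is `(0, -1)`. [folklore] -/
theorem cFace_orbT_zero : cFace (orbT N hN ω₀ 0) = ![0, -1] := by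
  dsimp only [orbT]
  rw [cornerOrbit_zero, startCorner_threeSided (W := 2 * N) (H := N) (by omega) hN]
  show faceAt ![0, 0] 3 = _
  funext i; fin_cases i <;> simp [faceAt, cornerOff]

/-- **The start face is odd.** [cite: DuminilCopinHonglerNolin2011, §4, proof of Lemma 15] -/
theorem not_faceParity_start {b : Site 2} (hbA : b ∈ (threeSided (2 * N) N).A)
    {π : (zdGraph 2).Walk (orbT N hN ω₀ n).1 b} (hπ : ∀ d ∈ π.darts, IsPiEdge N hN ω₀ n d.edge) :
    ¬ faceParity (fvWalk hN ω₀ n hbA π) (cFace (orbT N hN ω₀ 0)) := by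
  have ht := hV.hit.interior hKN
  rw [cFace_orbT_zero, faceParity_iff_even_downCount]
  simp only [Matrix.cons_val_zero, Matrix.cons_val_one]
  rw [downCount_fvWalk hV hKN hbA hπ le_rfl (Or.inl rfl), if_pos (by omega)]
  decide

/-- **All prefix faces `cFace (orb i)`, `i ≤ n`, are odd.** [cite: DuminilCopinHonglerNolin2011, §4, proof of Lemma 15] -/
theorem not_faceParity_prefix {b : Site 2} (hbA : b ∈ (threeSided (2 * N) N).A)
    {π : (zdGraph 2).Walk (orbT N hN ω₀ n).1 b} (hπ : ∀ d ∈ π.darts, IsPiEdge N hN ω₀ n d.edge) {i : ℕ} (hi : i ≤ n) :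
    ¬ faceParity (fvWalk hN ω₀ n hbA π) (cFace (orbT N hN ω₀ i)) := by
  rw [faceParity_prefix hV hKN hbA hπ i hi]
  exact not_faceParity_start hV hKN hbA hπ

/-- **The free-row faces left of the tip's column are odd**: `(x, -1)` for `0 ≤ x < t₀`.
[cite: DuminilCopinHonglerNolin2011, §4, proof of Lemma 15] -/
theorem not_faceParity_corridorLeft {b : Site 2} (hbA : b ∈ (threeSided (2 * N) N).A)
    {π : (zdGraph 2).Walk (orbT N hN ω₀ n).1 b} (hπ : ∀ d ∈ π.darts, IsPiEdge N hN ω₀ n d.edge)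
    {x : ℤ} (hx0 : 0 ≤ x) (hx : x + 1 ≤ (orbT N hN ω₀ n).1 0) :
    ¬ faceParity (fvWalk hN ω₀ n hbA π) ![x, -1] := by
  rw [faceParity_iff_even_downCount]
  simp only [Matrix.cons_val_zero, Matrix.cons_val_one]
  rw [downCount_fvWalk hV hKN hbA hπ hx0 (Or.inl rfl), if_pos hx]
  decide

/-- **The face `(N + K, 0)` at `z` is even** (when the tip is not `z`). [cite: DuminilCopinHonglerNolin2011, §4, proof of Lemma 15] -/
theorem faceParity_zFace {b : Site 2} (hbA : b ∈ (threeSided (2 * N) N).A)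
    {π : (zdGraph 2).Walk (orbT N hN ω₀ n).1 b} (hπ : ∀ d ∈ π.darts, IsPiEdge N hN ω₀ n d.edge)
    (htz : (orbT N hN ω₀ n).1 ≠ ![(N : ℤ) + K, 0]) :
    faceParity (fvWalk hN ω₀ n hbA π) ![(N : ℤ) + K, 0] := by
  have ht := hV.tip_bounds
  rw [faceParity_iff_even_downCount]
  simp only [Matrix.cons_val_zero, Matrix.cons_val_one]
  rw [downCount_fvWalk hV hKN hbA hπ (by positivity) (Or.inr ⟨rfl, rfl, htz⟩), if_neg (by omega)]
  decide

/-- **The free-row faces from the tip's column to `z` are even**: `(x, 0)` for `t₀ ≤ x ≤ N + K`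
(tip not `z`): from the face of `z` leftwards, across sides at diamond sites other than the tip and
off its column, which carry no dart of `Γ`. [cite: DuminilCopinHonglerNolin2011, §4, proof of Lemma 15] -/
theorem faceParity_row {b : Site 2} (hbA : b ∈ (threeSided (2 * N) N).A)
    {π : (zdGraph 2).Walk (orbT N hN ω₀ n).1 b} (hπ : ∀ d ∈ π.darts, IsPiEdge N hN ω₀ n d.edge)
    (htz : (orbT N hN ω₀ n).1 ≠ ![(N : ℤ) + K, 0]) :
    ∀ j : ℕ, (orbT N hN ω₀ n).1 0 + j ≤ N + K → faceParity (fvWalk hN ω₀ n hbA π) ![(N : ℤ) + K - j, 0] := by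
  have ht := hV.tip_bounds
  intro j hj
  induction j with
  | zero => simpa using faceParity_zFace hV hKN hbA hπ htz
  | succ j ih =>
    have ih' := ih (by push_cast at hj; omega)
    set g : Site 2 := ![(N : ℤ) + K - ((j + 1 : ℕ) : ℤ), 0] with hg
    have e : g + cornerUnit 0 = ![(N : ℤ) + K - j, 0] := by
      funext i; fin_cases i <;> simp [hg, cornerUnit]; ring
    rw [← e] at ih'
    refine (faceParity_add_cornerUnit_iff _ g 0 fun d hd heq => ?_).1 ih'
    -- the right side of `g` hangs at the diamond site `v = (N + K - j, 0) ≠ t`, off the tip's column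
    push_cast at hj
    have hv : IsDiamondSite N K ![(N : ℤ) + K - j, 0] := ⟨by simp, by simp; omega, by simp; omega⟩
    have hvc : (![(N : ℤ) + K - j, 0] : Site 2) 0 ≠ (orbT N hN ω₀ n).1 0 := by simp; omega
    have hvt : (![(N : ℤ) + K - j, 0] : Site 2) ≠ (orbT N hN ω₀ n).1 := fun h => hvc (by rw [h])
    refine not_mem_edge_of_isDiamondSite hV hKN hbA hπ hv hvt hvc hd ?_
    rw [heq, hg, faceSide]
    refine Sym2.mem_iff.2 (Or.inl ?_)
    funext i; fin_cases i
    · simp; omega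
    · simp

/-- **The faces right of the column below the tip are even**: `(t₀, y)` for `0 ≤ y < t₁`.
[cite: DuminilCopinHonglerNolin2011, §4, proof of Lemma 15] -/
theorem faceParity_colRight {b : Site 2} (hbA : b ∈ (threeSided (2 * N) N).A)
    {π : (zdGraph 2).Walk (orbT N hN ω₀ n).1 b} (hπ : ∀ d ∈ π.darts, IsPiEdge N hN ω₀ n d.edge)
    (htz : (orbT N hN ω₀ n).1 ≠ ![(N : ℤ) + K, 0]) :
    ∀ y : ℕ, (y : ℤ) + 1 ≤ (orbT N hN ω₀ n).1 1 → faceParity (fvWalk hN ω₀ n hbA π) ![(orbT N hN ω₀ n).1 0, (y : ℤ)] := by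
  have ht := hV.tip_bounds
  have htb := hV.tip_boundary hKN
  intro y hy
  induction y with
  | zero =>
    have := faceParity_row hV hKN hbA hπ htz (((N : ℤ) + K - (orbT N hN ω₀ n).1 0).toNat)
      (by rw [Int.toNat_of_nonneg (by omega)]; omega)
    rw [Int.toNat_of_nonneg (by omega)] at this
    simpa using this
  | succ y ih =>
    have ih' := ih (by push_cast at hy; omega)
    set g : Site 2 := ![(orbT N hN ω₀ n).1 0, (y : ℤ)] with hg
    have e : g + cornerUnit 1 = ![(orbT N hN ω₀ n).1 0, ((y + 1 : ℕ) : ℤ)] := by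
      funext i; fin_cases i <;> simp [hg, cornerUnit]
    rw [← e]
    refine (faceParity_add_cornerUnit_iff _ g 1 fun d hd heq => ?_).2 ih'
    -- the top side of `g` hangs at the diamond site `v = (t₀ + 1, y + 1)`, off the tip's column
    push_cast at hy
    have hv : IsDiamondSite N K ![(orbT N hN ω₀ n).1 0 + 1, (y : ℤ) + 1] := ⟨by simp; positivity, by simp; omega, by simp; omega⟩
    have hvc : (![(orbT N hN ω₀ n).1 0 + 1, (y : ℤ) + 1] : Site 2) 0 ≠ (orbT N hN ω₀ n).1 0 := by simp
    have hvt : (![(orbT N hN ω₀ n).1 0 + 1, (y : ℤ) + 1] : Site 2) ≠ (orbT N hN ω₀ n).1 := fun h => hvc (by rw [h])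
    refine not_mem_edge_of_isDiamondSite hV hKN hbA hπ hv hvt hvc hd ?_
    rw [heq, hg, faceSide]
    refine Sym2.mem_iff.2 (Or.inr ?_)
    funext i; fin_cases i <;> simp

open scoped Classical in
/-- **The column edges below the tip are traversed exactly once by `Γ`.** [cite: DuminilCopinHonglerNolin2011, §4, proof of Lemma 15] -/
theorem countP_onVEdge_col {b : Site 2} (hbA : b ∈ (threeSided (2 * N) N).A)
    {π : (zdGraph 2).Walk (orbT N hN ω₀ n).1 b} (hπ : ∀ d ∈ π.darts, IsPiEdge N hN ω₀ n d.edge)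
    {y : ℤ} (hy0 : 0 ≤ y) (hy : y + 1 ≤ (orbT N hN ω₀ n).1 1) :
    (fvWalk hN ω₀ n hbA π).darts.countP (fun d => decide (OnVEdge ((orbT N hN ω₀ n).1 0) y d)) = 1 := by
  classical
  have ht := hV.tip_bounds
  have htb := hV.tip_boundary hKN
  have hti := hV.hit.interior hKN
  have hb := wall_bounds hbA
  -- `π` does not use the column edges: both their endpoints are diamond sites
  have hπ0 : π.darts.countP (fun d => decide (OnVEdge ((orbT N hN ω₀ n).1 0) y d)) = 0 := by
    rw [List.countP_eq_zero]
    intro d hd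
    simp only [decide_eq_true_eq]
    intro hd'
    have he := edge_eq_of_onVEdge hd'
    obtain ⟨x, hx, hxD⟩ := (hπ d hd).exists_not_isDiamondSite hV
    rw [he, Sym2.mem_iff] at hx
    rcases hx with rfl | rfl
    · exact hxD ⟨by simp; omega, by simp; omega, by simp; omega⟩
    · exact hxD ⟨by simp; omega, by simp; omega, by simp; omega⟩
  -- the climb of the wall walk is off the column
  have hwall0 : (unitRun 1 (((N : ℤ) - b 1).toNat) b).darts.countP (fun d => decide (OnVEdge ((orbT N hN ω₀ n).1 0) y d)) = 0 := by
    by_cases hb1 : b 1 = N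
    · have : ((N : ℤ) - b 1).toNat = 0 := by rw [hb1]; simp
      rw [this]; simp [unitRun]
    · refine countP_onVEdge_unitRun_one_of_ne ?_ _ _
      rcases wall_lateral hbA (by omega) with h | h <;> rw [h] <;> omega
  simp only [fvWalk, crosscutWalk, wallWalk, SimpleGraph.Walk.darts_append, SimpleGraph.Walk.darts_copy, List.countP_append]
  rw [countP_darts_reverse _ _ (onVEdge_symm_iff _ _), countP_darts_reverse _ _ (onVEdge_symm_iff _ _), hπ0]
  simp only [SimpleGraph.Walk.darts_append, SimpleGraph.Walk.darts_copy, List.countP_append]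
  rw [countP_onVEdge_unitRun_three, countP_onVEdge_unitRun_horizontal (Or.inr rfl),
    countP_onVEdge_unitRun_one_of_ne (by simp; omega), countP_onVEdge_unitRun_horizontal (Or.inl rfl), hwall0,
    countP_onVEdge_unitRun_horizontal (Or.inr rfl)]
  have e1 : ((((orbT N hN ω₀ n).1 1).toNat + 2 : ℕ) : ℤ) = (orbT N hN ω₀ n).1 1 + 2 := by
    push_cast; rw [Int.toNat_of_nonneg ht.1]
  rw [e1, if_pos ⟨rfl, by omega, hy⟩]

/-- **The faces left of the column below the tip are odd**: `(t₀ - 1, y)` for `0 ≤ y < t₁` (the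
parity flips across the column edge, traversed once). [cite: DuminilCopinHonglerNolin2011, §4, proof of Lemma 15] -/
theorem not_faceParity_colLeft {b : Site 2} (hbA : b ∈ (threeSided (2 * N) N).A)
    {π : (zdGraph 2).Walk (orbT N hN ω₀ n).1 b} (hπ : ∀ d ∈ π.darts, IsPiEdge N hN ω₀ n d.edge)
    (htz : (orbT N hN ω₀ n).1 ≠ ![(N : ℤ) + K, 0]) {y : ℕ} (hy : (y : ℤ) + 1 ≤ (orbT N hN ω₀ n).1 1) :
    ¬ faceParity (fvWalk hN ω₀ n hbA π) ![(orbT N hN ω₀ n).1 0 - 1, (y : ℤ)] := by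
  set g : Site 2 := ![(orbT N hN ω₀ n).1 0 - 1, (y : ℤ)] with hg
  have e : g + cornerUnit 0 = ![(orbT N hN ω₀ n).1 0, (y : ℤ)] := by
    funext i; fin_cases i <;> simp [hg, cornerUnit]
  have hR := faceParity_colRight hV hKN hbA hπ htz y hy
  rw [← e] at hR
  have hcount := countP_onVEdge_col hV hKN hbA hπ (y := y) (by positivity) hy
  have e0 : g 0 + 1 = (orbT N hN ω₀ n).1 0 := by simp [hg]
  have e1' : g 1 = y := by simp [hg]
  have key := faceParity_add_cornerUnit_zero_iff_of_countP_eq_one (fvWalk hN ω₀ n hbA π) g (by rw [e0, e1']; exact hcount)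
  exact key.1 hR

omit hKN in
/-- **The sides used by the crosscut walk inside the box**: a dart of `Γ` whose edge has both
endpoints in the box lies on a revealed open explored edge, an `A`–`A` edge, a column edge
`{(t₀, y), (t₀, y+1)}` with `0 ≤ y < t₁`, or the foot edge `{(t₀, 0), (t₀, -1)}`.
[cite: DuminilCopinHonglerNolin2011, §4, proof of Lemma 15] -/
theorem edge_cases_of_dart {b : Site 2} (hbA : b ∈ (threeSided (2 * N) N).A)
    {π : (zdGraph 2).Walk (orbT N hN ω₀ n).1 b} (hπ : ∀ d ∈ π.darts, IsPiEdge N hN ω₀ n d.edge)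
    {d : (zdGraph 2).Dart} (hd : d ∈ (fvWalk hN ω₀ n hbA π).darts) (hS : ∀ x ∈ d.edge, x ∈ (threeSided (2 * N) N).S) :
    IsPiEdge N hN ω₀ n d.edge ∨ (∀ x ∈ d.edge, x ∈ (threeSided (2 * N) N).A) ∨
      (∃ y : ℤ, 0 ≤ y ∧ y + 1 ≤ (orbT N hN ω₀ n).1 1 ∧ d.edge = s(![(orbT N hN ω₀ n).1 0, y], ![(orbT N hN ω₀ n).1 0, y + 1])) ∨
      d.edge = s(![(orbT N hN ω₀ n).1 0, 0], ![(orbT N hN ω₀ n).1 0, -1]) := by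
  have ht := hV.tip_bounds
  have hb := wall_bounds hbA
  have hfst : d.fst ∈ (threeSided (2 * N) N).S := hS _ (by rw [SimpleGraph.Dart.edge]; exact Sym2.mem_mk_left _ _)
  have hsnd : d.snd ∈ (threeSided (2 * N) N).S := hS _ (by rw [SimpleGraph.Dart.edge]; exact Sym2.mem_mk_right _ _)
  rw [mem_threeSided_S] at hfst hsnd
  rcases mem_darts_crosscutWalk hd with h | h | h | h | h | h | h
  · -- column and foot run
    obtain ⟨j, hj, h1, h2⟩ := (mem_darts_unitRun_iff 3 _ _ d).1 h
    have ht1 : ((((orbT N hN ω₀ n).1 1).toNat : ℕ) : ℤ) = (orbT N hN ω₀ n).1 1 := Int.toNat_of_nonneg ht.1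
    have hf0 : d.fst 0 = (orbT N hN ω₀ n).1 0 := by rw [h1, add_nsmul_cornerUnit_apply]; simp [cornerUnit]
    have hf1 : d.fst 1 = (orbT N hN ω₀ n).1 1 - j := by rw [h1, add_nsmul_cornerUnit_apply]; simp [cornerUnit]; ring
    have hs0 : d.snd 0 = (orbT N hN ω₀ n).1 0 := by rw [h2, add_nsmul_cornerUnit_apply]; simp [cornerUnit]
    have hs1 : d.snd 1 = (orbT N hN ω₀ n).1 1 - (j + 1) := by
      rw [h2, add_nsmul_cornerUnit_apply]; simp [cornerUnit]; ring
    have hfe : d.fst = ![(orbT N hN ω₀ n).1 0, (orbT N hN ω₀ n).1 1 - j] := by funext i; fin_cases i <;> simp [hf0, hf1]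
    have hse : d.snd = ![(orbT N hN ω₀ n).1 0, (orbT N hN ω₀ n).1 1 - (j + 1)] := by funext i; fin_cases i <;> simp [hs0, hs1]
    have hedge : d.edge = s(![(orbT N hN ω₀ n).1 0, (orbT N hN ω₀ n).1 1 - (j + 1)], ![(orbT N hN ω₀ n).1 0, (orbT N hN ω₀ n).1 1 - j]) := by
      rw [SimpleGraph.Dart.edge, Sym2.eq_swap, hfe, hse]
    rcases lt_trichotomy ((j : ℤ) + 1) ((orbT N hN ω₀ n).1 1 + 1) with hlt | heq | hgt
    · right; right; left
      refine ⟨(orbT N hN ω₀ n).1 1 - (j + 1), by omega, by omega, ?_⟩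
      rw [hedge]
      have eb : (![(orbT N hN ω₀ n).1 0, (orbT N hN ω₀ n).1 1 - j] : Site 2) = ![(orbT N hN ω₀ n).1 0, (orbT N hN ω₀ n).1 1 - (j + 1) + 1] := by
        funext i; fin_cases i <;> simp; ring
      rw [eb]
    · right; right; right
      have hj' : (j : ℤ) = (orbT N hN ω₀ n).1 1 := by omega
      rw [hedge, Sym2.eq_swap, hj']
      have ea : (![(orbT N hN ω₀ n).1 0, (orbT N hN ω₀ n).1 1 - (orbT N hN ω₀ n).1 1] : Site 2) = ![(orbT N hN ω₀ n).1 0, 0] := by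
        funext i; fin_cases i <;> simp
      have eb : (![(orbT N hN ω₀ n).1 0, (orbT N hN ω₀ n).1 1 - ((orbT N hN ω₀ n).1 1 + 1)] : Site 2) = ![(orbT N hN ω₀ n).1 0, -1] := by
        funext i; fin_cases i <;> simp
      rw [ea, eb]
    · exfalso; rw [hs1] at hsnd; omega
  · obtain ⟨j, -, h1, -⟩ := (mem_darts_unitRun_iff 2 _ _ d).1 h
    exfalso; rw [h1, add_nsmul_cornerUnit_apply, add_nsmul_cornerUnit_apply] at hfst; simp [cornerUnit] at hfst
  · obtain ⟨j, -, h1, -⟩ := (mem_darts_unitRun_iff 1 _ _ d).1 h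
    exfalso; rw [h1, add_nsmul_cornerUnit_apply, add_nsmul_cornerUnit_apply] at hfst; simp [cornerUnit] at hfst
  · obtain ⟨j, hj, h1, -⟩ := (mem_darts_unitRun_iff 0 _ _ d).1 h
    exfalso; rw [h1, add_nsmul_cornerUnit_apply, add_nsmul_cornerUnit_apply] at hfst; simp [cornerUnit] at hfst; omega
  · -- wall climb: `A`–`A`
    right; left
    obtain ⟨j, hj, h1, h2⟩ := (mem_darts_unitRun_iff 1 _ _ d.symm).1 h
    have hlat : b 0 = 0 ∨ b 0 = 2 * (N : ℤ) := wall_lateral hbA (by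
      by_contra hge; have : ((N : ℤ) - b 1).toNat = 0 := by simp; omega
      omega)
    have htoNat : ((((N : ℤ) - b 1).toNat : ℕ) : ℤ) = N - b 1 := Int.toNat_of_nonneg (by omega)
    rw [mem_threeSided_A] at hbA
    intro x hx
    rw [← SimpleGraph.Dart.edge_symm, SimpleGraph.Dart.edge, Sym2.mem_iff, h1, h2] at hx
    rw [mem_threeSided_A]
    rcases hx with rfl | rfl <;> simp only [add_nsmul_cornerUnit_apply] <;> simp [cornerUnit] <;> omega
  · -- wall top row: `A`–`A`
    right; left
    obtain ⟨j, hj, h1, h2⟩ := (mem_darts_unitRun_iff 2 _ _ d.symm).1 h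
    have htoNat : (((b 0).toNat : ℕ) : ℤ) = b 0 := Int.toNat_of_nonneg hb.1
    rw [mem_threeSided_A] at hbA
    intro x hx
    rw [← SimpleGraph.Dart.edge_symm, SimpleGraph.Dart.edge, Sym2.mem_iff, h1, h2] at hx
    rw [mem_threeSided_A]
    rcases hx with rfl | rfl <;> simp only [add_nsmul_cornerUnit_apply] <;> simp [cornerUnit] <;> omega
  · left; rw [← SimpleGraph.Dart.edge_symm]; exact hπ _ h

end Parities

end LatticeDobrushin

end Literature.Probability.LatticeModels
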